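import Mathlib
import HarnessLib

/-!
# Generalized `φ`-contractions and Ćirić's quasi-contraction theorem

Source: V. Berinde, *Iterative Approximation of Fixed Points*, 2nd ed., Lecture Notes in
Mathematics 1912, Springer (2007) [Berinde2007], Chapter 2, §2.6 "Generalized `φ`-contractions"
(Definition 2.4, Example 2.10, Definition 2.5, Lemma 2.3, the Remark after it, Lemma 2.4,
Theorem 2.10 and the list "Particular cases" 1)–5) after its proof), pp. 43–46; and the theorem
this section was designed to unify: Lj. B. Ćirić, *A generalization of Banach's contraction
principle*, Proc. Amer. Math. Soc. 45 (1974) 267–273 [Ciric1974] (Ćirić's quasi-contractions,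
his Lemmas 1–3 and Theorem 1 with the estimate `d(Tⁿx, x*) ≤ qⁿ/(1 - q) · d(x, Tx)`).

Let `(X, d)` be a metric space and `T : X → X`.  A map `φ : ℝ₊⁵ → ℝ₊` is a *(5-dimensional)
comparison function* (Definition 2.4, `IsComparisonFunction5`) if it is monotone increasing in
each variable and its diagonal

  `ψ(t) = φ(t, t, t, t, t)`                                                            (23)

(`diag φ`) satisfies `ψⁿ(t) → 0` for every `t ≥ 0`.  `T` is a *generalized `φ`-contraction*
(Definition 2.5, `IsGeneralizedPhiContraction`) if

  `d(Tx, Ty) ≤ φ(d(x, y), d(x, Tx), d(y, Ty), d(x, Ty), d(y, Tx))` for all `x, y`.     (24)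

Writing `xₙ = Tⁿ x₀` and `δ(O_T(x₀; n))` for the diameter of the orbit segment
`{x₀, Tx₀, …, Tⁿx₀}` (`orbitDiam T x₀ n`), this file proves:

* Lemma 2.3: `d(Tⁱx₀, Tʲx₀) ≤ ψ(δ(O_T(x₀; n)))` for `1 ≤ i, j ≤ n`
  (`IsGeneralizedPhiContraction.dist_iterate_le_diag_orbitDiam`), in the sharper iterated form
  used inside the proof of Theorem 2.10, `d(xᵢ, xⱼ) ≤ ψᵏ(δ(O_T(x₀; m)))` for `k ≤ i, j ≤ m`
  (`….dist_iterate_le_iterate_diag_orbitDiam`; this is Ćirić's Lemma 1 iterated);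
* the Remark after Lemma 2.3 (Ćirić's Lemma 2): `δ(O_T(x₀; n)) = d(x₀, Tᵏx₀)` for some `k ≤ n`
  (`….exists_orbitDiam_eq_dist`);
* Lemma 2.4 (Ćirić's Lemma 3): `δ(O_T(x₀; n)) - ψ(δ(O_T(x₀; n))) ≤ d(x₀, Tx₀)`
  (`….orbitDiam_sub_diag_le`), hence `δ(O_T(x₀; n)) ≤ h⁻¹(d(x₀, Tx₀))` whenever `h(t) = t - ψ(t)`
  admits an increasing inverse (`….orbitDiam_le_of_inverse`, see deviation (b));
* Theorem 2.10: in a complete metric space, if `ψ` is continuous and `h` is an increasing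
  bijection, `T` is a Picard mapping — a unique fixed point `x*`, every Picard sequence converges
  to it — with the estimate (ii) `d(Tⁿx₀, x*) ≤ ψⁿ(h⁻¹(d(x₀, Tx₀)))`
  (`….exists_fixedPoint_tendsto_iterate`, `….fixedPoint_unique`,
  `….dist_iterate_fixedPoint_le`, `….existsUnique_fixedPoint`); the orbit-wise version only
  needs a bound `δ(O_T(x₀; m)) ≤ R` for all `m`
  (`….exists_fixedPoint_tendsto_iterate_of_orbitDiam_le`);
* the linear-diagonal case `ψ(t) = c t`, `c < 1`, covering Example 2.10 1)–5), 7): then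
  `h⁻¹(s) = s/(1 - c)` and `d(Tⁿx₀, x*) ≤ cⁿ/(1 - c) · d(x₀, Tx₀)` (`….picard_of_linear`);
* Particular cases: 1) Ćirić's theorem [Ciric1974, Theorem 1] for quasi-contractions
  `d(Tx, Ty) ≤ a · max {d(x, y), d(x, Tx), d(y, Ty), d(x, Ty), d(y, Tx)}`, `a ∈ [0, 1)`
  (`IsQuasiContraction`, `IsQuasiContraction.existsUnique_fixedPoint`,
  `….tendsto_iterate_fixedPoint`, `….dist_iterate_fixedPoint_le` with Ćirić's rate
  `aⁿ/(1 - a) · d(x₀, Tx₀)`, and Ćirić's Lemma 3 `….orbitDiam_le`); 2) Kannan's theorem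
  (`picard_of_kannan`); 3) the Reich–Rus theorem (`picard_of_reichRus`); 4) the Bianchini
  theorem (`picard_of_bianchini`); 5) Zamfirescu's theorem (`picard_of_zamfirescu`); and, for
  completeness of Berinde's Remark 4 in §2.7, Chatterjea's condition (34) (`picard_of_chatterjea`).
  Each comes with the estimate furnished by Theorem 2.10 (ii).

Kannan's, Chatterjea's and Zamfirescu's theorems are also obtained, by Berinde's other route
(§2.3/§2.7, weak contractions), in `Literature.Analysis.Convex.AlmostContractions`; the present
file derives them from Theorem 2.10 as Berinde does in §2.6 and records the (different) error
constants that Theorem 2.10 (ii) produces; the structures `IsKannanMapping`, … of that file are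
not redeclared here (the hypotheses are written out).

Deviations from the source (declared).  (a) `φ` is a curried total function
`ℝ → ℝ → ℝ → ℝ → ℝ → ℝ`; monotonicity, nonnegativity and `ψⁿ(t) → 0` are required only on
nonnegative arguments (a comparison function on `ℝ₊⁵` extends by `0`).  (b) Berinde's hypothesis
"`h(t) = t - ψ(t)` is an increasing bijection of `ℝ₊`" enters the proofs only through its
consequence `t ≥ 0 ∧ t - ψ(t) ≤ s ⟹ t ≤ g(s)` for `g = h⁻¹`; we take such a `g` as the datum
(`hg`), which is literally what Lemma 2.4 and estimate (ii) use, and we also state Lemma 2.4 in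
the inverse-free form `δ - ψ(δ) ≤ d(x₀, Tx₀)`.  (c) Continuity of `ψ` is needed only on `[0, ∞)`
(`ContinuousOn (diag φ) (Set.Ici 0)`), and is used exactly once, to show that the limit of a
Picard sequence is a fixed point; instead of Berinde's five-way case analysis of (30) we bound all
five displacements by `d(x*, Tx*) + εₙ` with `εₙ → 0` and use monotonicity.  (d) Ćirić proves his
theorem on `T`-orbitally complete spaces; like Berinde we assume `(X, d)` complete.  (e) In
Example 2.10 7) the book prints `max {a t₁, b(t₂ + t₄), c(t₃ + t₅)}`; with the ordering of (24)
Zamfirescu's conditions (z₂), (z₃) of Theorem 2.4 are `b(t₂ + t₃)` and `c(t₄ + t₅)`, which is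
what `picard_of_zamfirescu` uses.  (f) All constants are allowed to vanish (`a ∈ [0, 1)` etc.).
-/

open Filter Topology Function Set

namespace Literature.Analysis.Convex.GeneralizedPhiContractions

/-! ## Five-dimensional comparison functions (Definition 2.4) -/

/-- The diagonal `ψ(t) = φ(t, t, t, t, t)` of a five-variable function `φ`, Berinde's (23).
[cite: Berinde2007, Ch. 2 §2.6 Def. 2.4 (23)] -/
def diag (φ : ℝ → ℝ → ℝ → ℝ → ℝ → ℝ) : ℝ → ℝ := fun t => φ t t t t t

/-- `ψ(t) = φ(t, t, t, t, t)` by definition. [cite: Berinde2007, Ch. 2 §2.6 Def. 2.4 (23)] -/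
@[simp] theorem diag_apply (φ : ℝ → ℝ → ℝ → ℝ → ℝ → ℝ) (t : ℝ) : diag φ t = φ t t t t t := rfl

/-- Definition 2.4: a *5-dimensional comparison function* is a map `φ : ℝ₊⁵ → ℝ₊` which is
monotone increasing (`u ≤ v` coordinatewise implies `φ u ≤ φ v`) and whose diagonal
`ψ(t) = φ(t, t, t, t, t)` satisfies `(v_φ)`: `ψⁿ(t) → 0` for every `t ≥ 0`.  We take `φ` total on
`ℝ⁵` and ask for monotonicity, nonnegativity and `(v_φ)` on nonnegative arguments only.
[cite: Berinde2007, Ch. 2 §2.6 Def. 2.4] -/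
structure IsComparisonFunction5 (φ : ℝ → ℝ → ℝ → ℝ → ℝ → ℝ) : Prop where
  mono : ∀ ⦃t₁ t₂ t₃ t₄ t₅ s₁ s₂ s₃ s₄ s₅ : ℝ⦄, 0 ≤ t₁ → 0 ≤ t₂ → 0 ≤ t₃ → 0 ≤ t₄ → 0 ≤ t₅ →
    t₁ ≤ s₁ → t₂ ≤ s₂ → t₃ ≤ s₃ → t₄ ≤ s₄ → t₅ ≤ s₅ → φ t₁ t₂ t₃ t₄ t₅ ≤ φ s₁ s₂ s₃ s₄ s₅
  nonneg : ∀ ⦃t₁ t₂ t₃ t₄ t₅ : ℝ⦄, 0 ≤ t₁ → 0 ≤ t₂ → 0 ≤ t₃ → 0 ≤ t₄ → 0 ≤ t₅ →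
    0 ≤ φ t₁ t₂ t₃ t₄ t₅
  tendsto_iterate_diag : ∀ ⦃t : ℝ⦄, 0 ≤ t → Tendsto (fun n : ℕ => (diag φ)^[n] t) atTop (𝓝 0)

namespace IsComparisonFunction5

section Consequences

variable {φ : ℝ → ℝ → ℝ → ℝ → ℝ → ℝ} (hφ : IsComparisonFunction5 φ)
include hφ

/-- `ψ(t) ≥ 0` for `t ≥ 0`. [cite: Berinde2007, Ch. 2 §2.6 Def. 2.4] -/
theorem diag_nonneg {t : ℝ} (ht : 0 ≤ t) : 0 ≤ diag φ t := hφ.nonneg ht ht ht ht ht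

/-- `ψ` is monotone increasing on `[0, ∞)` (condition `(i_φ)` for `ψ`).
[cite: Berinde2007, Ch. 2 §2.6 Def. 2.4] -/
theorem diag_mono {s t : ℝ} (hs : 0 ≤ s) (hst : s ≤ t) : diag φ s ≤ diag φ t :=
  hφ.mono hs hs hs hs hs hst hst hst hst hst

/-- Monotonicity in the form used throughout §2.6: if all five (nonnegative) arguments are
`≤ M`, then `φ(t₁, …, t₅) ≤ ψ(M)`. [cite: Berinde2007, Ch. 2 §2.6 proof of Lemma 2.3] -/
theorem le_diag {t₁ t₂ t₃ t₄ t₅ M : ℝ} (h₁ : 0 ≤ t₁) (h₂ : 0 ≤ t₂) (h₃ : 0 ≤ t₃) (h₄ : 0 ≤ t₄)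
    (h₅ : 0 ≤ t₅) (k₁ : t₁ ≤ M) (k₂ : t₂ ≤ M) (k₃ : t₃ ≤ M) (k₄ : t₄ ≤ M) (k₅ : t₅ ≤ M) :
    φ t₁ t₂ t₃ t₄ t₅ ≤ diag φ M :=
  hφ.mono h₁ h₂ h₃ h₄ h₅ k₁ k₂ k₃ k₄ k₅

/-- `ψⁿ(t) ≥ 0` for `t ≥ 0`. [cite: Berinde2007, Ch. 2 §2.6 Def. 2.4] -/
theorem iterate_diag_nonneg {t : ℝ} (ht : 0 ≤ t) (n : ℕ) : 0 ≤ (diag φ)^[n] t := by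
  induction n with
  | zero => simpa using ht
  | succ n ih => rw [iterate_succ_apply']; exact hφ.diag_nonneg ih

/-- `ψⁿ` is monotone increasing on `[0, ∞)`. [cite: Berinde2007, Ch. 2 §2.6 Def. 2.4] -/
theorem iterate_diag_mono {s t : ℝ} (hs : 0 ≤ s) (hst : s ≤ t) (n : ℕ) :
    (diag φ)^[n] s ≤ (diag φ)^[n] t := by
  induction n with
  | zero => simpa using hst
  | succ n ih =>
    rw [iterate_succ_apply', iterate_succ_apply']
    exact hφ.diag_mono (hφ.iterate_diag_nonneg hs n) ih

/-- Lemma 2.1 3) for the diagonal: `(i_φ)` and `(v_φ)` imply `(ii_φ)`, i.e. `ψ(t) < t` for every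
`t > 0`. [cite: Berinde2007, Ch. 2 §2.5 Lemma 2.1 3)] -/
theorem diag_lt_self {t : ℝ} (ht : 0 < t) : diag φ t < t := by
  by_contra h
  have h' : t ≤ diag φ t := not_lt.1 h
  have key : ∀ n : ℕ, t ≤ (diag φ)^[n] t := by
    intro n
    induction n with
    | zero => simp
    | succ n ih =>
      rw [iterate_succ_apply]
      exact ih.trans (hφ.iterate_diag_mono ht.le h' n)
  have h0 : t ≤ 0 := ge_of_tendsto' (hφ.tendsto_iterate_diag ht.le) key
  exact absurd h0 (not_le.2 ht)

/-- If `0 ≤ t ≤ ψ(t)` then `t = 0` (the form in which `(ii_φ)` is used in the proofs of the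
Remark after Lemma 2.3 and of Theorem 2.10). [cite: Berinde2007, Ch. 2 §2.5 Lemma 2.1 3)] -/
theorem eq_zero_of_le_diag {t : ℝ} (ht : 0 ≤ t) (h : t ≤ diag φ t) : t = 0 := by
  rcases ht.eq_or_lt with h0 | ht'
  · exact h0.symm
  · exact absurd h (not_le.2 (hφ.diag_lt_self ht'))

/-- Lemma 2.1 1) for the diagonal: `ψ(0) = 0` (condition `(iii_φ)`).
[cite: Berinde2007, Ch. 2 §2.5 Lemma 2.1 1)] -/
theorem diag_zero : diag φ 0 = 0 := by
  have h0 : 0 ≤ diag φ 0 := hφ.diag_nonneg le_rfl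
  exact hφ.eq_zero_of_le_diag h0 (hφ.diag_mono le_rfl h0)

end Consequences

section Linear

variable {φ : ℝ → ℝ → ℝ → ℝ → ℝ → ℝ} {c : ℝ}

/-- If `φ ≥ 0` on `ℝ₊⁵` and `ψ(t) = c t` on `[0, ∞)`, then `c = ψ(1) ≥ 0`.
[cite: Berinde2007, Ch. 2 §2.6 Example 2.10] -/
theorem linear_coeff_nonneg
    (nonneg : ∀ ⦃t₁ t₂ t₃ t₄ t₅ : ℝ⦄, 0 ≤ t₁ → 0 ≤ t₂ → 0 ≤ t₃ → 0 ≤ t₄ → 0 ≤ t₅ →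
      0 ≤ φ t₁ t₂ t₃ t₄ t₅)
    (hψ : ∀ t, 0 ≤ t → diag φ t = c * t) : 0 ≤ c := by
  have h1 : diag φ 1 = c * 1 := hψ 1 zero_le_one
  rw [mul_one, diag_apply] at h1
  rw [← h1]
  exact nonneg zero_le_one zero_le_one zero_le_one zero_le_one zero_le_one

/-- For a linear diagonal `ψ(t) = c t` with `c ≥ 0`: `ψⁿ(t) = cⁿ t` on `[0, ∞)`.
[cite: Berinde2007, Ch. 2 §2.6 Example 2.10] -/
theorem iterate_diag_linear (hc : 0 ≤ c) (hψ : ∀ t, 0 ≤ t → diag φ t = c * t) {t : ℝ}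
    (ht : 0 ≤ t) (n : ℕ) : (diag φ)^[n] t = c ^ n * t := by
  induction n with
  | zero => simp
  | succ n ih =>
    rw [iterate_succ_apply', ih, hψ _ (by positivity), pow_succ]
    ring

/-- Example 2.10 (the common feature of the functions 1)–5), 7) listed there): a monotone,
nonnegative `φ` whose diagonal is linear, `ψ(t) = c t` with `c < 1`, is a 5-dimensional
comparison function (`ψⁿ(t) = cⁿ t → 0`). [cite: Berinde2007, Ch. 2 §2.6 Example 2.10] -/
theorem of_linear
    (mono : ∀ ⦃t₁ t₂ t₃ t₄ t₅ s₁ s₂ s₃ s₄ s₅ : ℝ⦄, 0 ≤ t₁ → 0 ≤ t₂ → 0 ≤ t₃ → 0 ≤ t₄ → 0 ≤ t₅ →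
      t₁ ≤ s₁ → t₂ ≤ s₂ → t₃ ≤ s₃ → t₄ ≤ s₄ → t₅ ≤ s₅ → φ t₁ t₂ t₃ t₄ t₅ ≤ φ s₁ s₂ s₃ s₄ s₅)
    (nonneg : ∀ ⦃t₁ t₂ t₃ t₄ t₅ : ℝ⦄, 0 ≤ t₁ → 0 ≤ t₂ → 0 ≤ t₃ → 0 ≤ t₄ → 0 ≤ t₅ →
      0 ≤ φ t₁ t₂ t₃ t₄ t₅)
    (hc : c < 1) (hψ : ∀ t, 0 ≤ t → diag φ t = c * t) : IsComparisonFunction5 φ where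
  mono := mono
  nonneg := nonneg
  tendsto_iterate_diag := by
    intro t ht
    have hc0 : 0 ≤ c := linear_coeff_nonneg nonneg hψ
    have h : (fun n : ℕ => (diag φ)^[n] t) = fun n : ℕ => c ^ n * t :=
      funext fun n => iterate_diag_linear hc0 hψ ht n
    rw [h]
    simpa using (tendsto_pow_atTop_nhds_zero_of_lt_one hc0 hc).mul_const t

/-- For a linear diagonal `ψ(t) = c t`, `ψ` is continuous on `[0, ∞)` (the continuity
hypothesis of Theorem 2.10). [cite: Berinde2007, Ch. 2 §2.6 Example 2.10] -/
theorem continuousOn_diag_linear (hψ : ∀ t, 0 ≤ t → diag φ t = c * t) :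
    ContinuousOn (diag φ) (Ici 0) :=
  (continuous_const.mul continuous_id).continuousOn.congr fun t ht => hψ t ht

/-- For a linear diagonal `ψ(t) = c t` with `c < 1`, the function `h(t) = t - ψ(t) = (1 - c) t`
of (25) is an increasing bijection of `ℝ₊` with inverse `h⁻¹(s) = s/(1 - c)`: every `t ≥ 0`
with `t - ψ(t) ≤ s` satisfies `t ≤ s/(1 - c)`. [cite: Berinde2007, Ch. 2 §2.6 (25)] -/
theorem le_div_of_sub_diag_le_linear (hc : c < 1) (hψ : ∀ t, 0 ≤ t → diag φ t = c * t) :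
    ∀ ⦃s t : ℝ⦄, 0 ≤ t → t - diag φ t ≤ s → t ≤ s / (1 - c) := by
  intro s t ht h
  rw [hψ t ht] at h
  rw [le_div_iff₀ (by linarith)]
  have : t * (1 - c) = t - c * t := by ring
  linarith

end Linear

end IsComparisonFunction5

/-! ## Orbit segments and their diameters -/

variable {X : Type*} [MetricSpace X]

/-- `δ(O_T(x; n))`: the diameter of the orbit segment `O_T(x; n) = {x, Tx, …, Tⁿx}`, i.e.
`max {d(Tᵖx, T^q x) : 0 ≤ p, q ≤ n}`. [cite: Berinde2007, Ch. 2 §2.6 Lemma 2.3] -/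
noncomputable def orbitDiam (T : X → X) (x : X) (n : ℕ) : ℝ :=
  (Finset.range (n + 1) ×ˢ Finset.range (n + 1)).sup'
    ((Finset.nonempty_range_add_one (n := n)).product (Finset.nonempty_range_add_one (n := n)))
    (fun pq : ℕ × ℕ => dist (T^[pq.1] x) (T^[pq.2] x))

section OrbitDiam

variable (T : X → X) (x : X)

/-- Every distance `d(Tᵖx, T^q x)` with `p, q ≤ n` is at most `δ(O_T(x; n))`.
[cite: Berinde2007, Ch. 2 §2.6 proof of Lemma 2.3] -/
theorem dist_iterate_le_orbitDiam {n p q : ℕ} (hp : p ≤ n) (hq : q ≤ n) :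
    dist (T^[p] x) (T^[q] x) ≤ orbitDiam T x n := by
  have hmem : (p, q) ∈ Finset.range (n + 1) ×ˢ Finset.range (n + 1) := by
    rw [Finset.mem_product, Finset.mem_range, Finset.mem_range]
    omega
  exact Finset.le_sup' (fun pq : ℕ × ℕ => dist (T^[pq.1] x) (T^[pq.2] x)) hmem

/-- `δ(O_T(x; n)) ≥ 0`. [cite: Berinde2007, Ch. 2 §2.6 Lemma 2.3] -/
theorem orbitDiam_nonneg (n : ℕ) : 0 ≤ orbitDiam T x n := by
  have h := dist_iterate_le_orbitDiam T x (Nat.zero_le n) (Nat.zero_le n)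
  simpa using h

/-- A common bound of all `d(Tᵖx, T^q x)`, `p, q ≤ n`, bounds `δ(O_T(x; n))`.
[cite: Berinde2007, Ch. 2 §2.6 Lemma 2.3] -/
theorem orbitDiam_le {n : ℕ} {M : ℝ}
    (h : ∀ p q : ℕ, p ≤ n → q ≤ n → dist (T^[p] x) (T^[q] x) ≤ M) : orbitDiam T x n ≤ M := by
  refine Finset.sup'_le _ _ fun pq hpq => ?_
  rw [Finset.mem_product, Finset.mem_range, Finset.mem_range] at hpq
  exact h pq.1 pq.2 (by omega) (by omega)

/-- The diameter of a (finite) orbit segment is attained: `δ(O_T(x; n)) = d(Tᵖx, T^q x)` for some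
`p, q ≤ n`. [cite: Berinde2007, Ch. 2 §2.6 Remark after Lemma 2.3] -/
theorem exists_orbitDiam_eq (n : ℕ) :
    ∃ p q : ℕ, p ≤ n ∧ q ≤ n ∧ orbitDiam T x n = dist (T^[p] x) (T^[q] x) := by
  obtain ⟨pq, hmem, heq⟩ := Finset.exists_mem_eq_sup'
    ((Finset.nonempty_range_add_one (n := n)).product (Finset.nonempty_range_add_one (n := n)))
    (fun pq : ℕ × ℕ => dist (T^[pq.1] x) (T^[pq.2] x))
  rw [Finset.mem_product, Finset.mem_range, Finset.mem_range] at hmem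
  exact ⟨pq.1, pq.2, by omega, by omega, heq⟩

/-- `δ(O_T(x; n))` is monotone increasing in `n` (the segments are nested).
[cite: Berinde2007, Ch. 2 §2.6 proof of Thm. 2.10] -/
theorem orbitDiam_mono : Monotone (orbitDiam T x) := fun _ _ hmn =>
  orbitDiam_le T x fun _ _ hp hq => dist_iterate_le_orbitDiam T x (hp.trans hmn) (hq.trans hmn)

/-- `O_T(Tᵏx; n) ⊆ O_T(x; n + k)`, hence `δ(O_T(Tᵏx; n)) ≤ δ(O_T(x; n + k))` (used in the proof of
Theorem 2.10 with `k = 1`). [cite: Berinde2007, Ch. 2 §2.6 proof of Thm. 2.10 (26)–(28)] -/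
theorem orbitDiam_iterate_le (k n : ℕ) : orbitDiam T (T^[k] x) n ≤ orbitDiam T x (n + k) := by
  refine orbitDiam_le T _ fun p q hp hq => ?_
  rw [← iterate_add_apply, ← iterate_add_apply]
  exact dist_iterate_le_orbitDiam T x (by omega) (by omega)

/-- `δ(O_T(x; 0)) = δ({x}) = 0`. [cite: Berinde2007, Ch. 2 §2.6 proof of Thm. 2.10 (uniqueness)] -/
@[simp] theorem orbitDiam_zero_right : orbitDiam T x 0 = 0 := by
  refine le_antisymm (orbitDiam_le T x fun p q hp hq => ?_) (orbitDiam_nonneg T x 0)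
  obtain rfl : p = 0 := Nat.le_zero.1 hp
  obtain rfl : q = 0 := Nat.le_zero.1 hq
  simp

/-- The orbit segments of a fixed point are singletons: `δ(O_T(x*; n)) = 0`.
[cite: Berinde2007, Ch. 2 §2.6 proof of Thm. 2.10 (uniqueness)] -/
theorem orbitDiam_eq_zero_of_isFixedPt {T : X → X} {p : X} (hp : T p = p) (n : ℕ) :
    orbitDiam T p n = 0 := by
  refine le_antisymm (orbitDiam_le T p fun i j _ _ => ?_) (orbitDiam_nonneg T p n)
  have hfix : IsFixedPt T p := hp
  rw [hfix.iterate i, hfix.iterate j, dist_self]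

end OrbitDiam

/-! ## Generalized `φ`-contractions (Definition 2.5) -/

/-- Definition 2.5, condition (24): `T` is a *generalized `φ`-contraction* if
`d(Tx, Ty) ≤ φ(d(x, y), d(x, Tx), d(y, Ty), d(x, Ty), d(y, Tx))` for all `x, y`.
[cite: Berinde2007, Ch. 2 §2.6 Def. 2.5 (24)] -/
def IsGeneralizedPhiContraction (T : X → X) (φ : ℝ → ℝ → ℝ → ℝ → ℝ → ℝ) : Prop :=
  ∀ x y : X,
    dist (T x) (T y) ≤ φ (dist x y) (dist x (T x)) (dist y (T y)) (dist x (T y)) (dist y (T x))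

namespace IsGeneralizedPhiContraction

variable {T : X → X} {φ : ℝ → ℝ → ℝ → ℝ → ℝ → ℝ}

/-- The iterated form of Lemma 2.3 (Ćirić's Lemma 1 applied `k` times, as in the inductive step
"(26)–(29)" of the proof of Theorem 2.10): for `k ≤ i, j ≤ m`,
`d(Tⁱx, Tʲx) ≤ ψᵏ(δ(O_T(x; m)))`.
[cite: Berinde2007, Ch. 2 §2.6 Lemma 2.3 and proof of Thm. 2.10 (26)–(29)] -/
theorem dist_iterate_le_iterate_diag_orbitDiam (hφ : IsComparisonFunction5 φ)
    (hT : IsGeneralizedPhiContraction T φ) (x : X) :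
    ∀ k m i j : ℕ, k ≤ i → i ≤ m → k ≤ j → j ≤ m →
      dist (T^[i] x) (T^[j] x) ≤ (diag φ)^[k] (orbitDiam T x m) := by
  intro k
  induction k with
  | zero =>
    intro m i j _ hi _ hj
    simpa using dist_iterate_le_orbitDiam T x hi hj
  | succ k ih =>
    intro m i j hi him hj hjm
    obtain ⟨i', rfl⟩ : ∃ i', i = i' + 1 := ⟨i - 1, by omega⟩
    obtain ⟨j', rfl⟩ : ∃ j', j = j' + 1 := ⟨j - 1, by omega⟩
    rw [iterate_succ_apply' T i', iterate_succ_apply' T j', iterate_succ_apply' (diag φ) k]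
    refine (hT _ _).trans
      (hφ.le_diag dist_nonneg dist_nonneg dist_nonneg dist_nonneg dist_nonneg ?_ ?_ ?_ ?_ ?_)
    · exact ih m i' j' (by omega) (by omega) (by omega) (by omega)
    · rw [← iterate_succ_apply' T i' x]
      exact ih m i' (i' + 1) (by omega) (by omega) (by omega) (by omega)
    · rw [← iterate_succ_apply' T j' x]
      exact ih m j' (j' + 1) (by omega) (by omega) (by omega) (by omega)
    · rw [← iterate_succ_apply' T j' x]
      exact ih m i' (j' + 1) (by omega) (by omega) (by omega) (by omega)
    · rw [← iterate_succ_apply' T i' x]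
      exact ih m j' (i' + 1) (by omega) (by omega) (by omega) (by omega)

/-- Lemma 2.3 (Ćirić's Lemma 1): for a generalized `φ`-contraction and `1 ≤ i, j ≤ n`,
`d(Tⁱx₀, Tʲx₀) ≤ ψ(δ(O_T(x₀; n)))`. [cite: Berinde2007, Ch. 2 §2.6 Lemma 2.3] -/
theorem dist_iterate_le_diag_orbitDiam (hφ : IsComparisonFunction5 φ)
    (hT : IsGeneralizedPhiContraction T φ) (x : X) {n i j : ℕ} (hi : 1 ≤ i) (hin : i ≤ n)
    (hj : 1 ≤ j) (hjn : j ≤ n) : dist (T^[i] x) (T^[j] x) ≤ diag φ (orbitDiam T x n) := by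
  simpa using dist_iterate_le_iterate_diag_orbitDiam hφ hT x 1 n i j hi hin hj hjn

/-- Remark after Lemma 2.3 (Ćirić's Lemma 2): for each `n` there is `k ≤ n` with
`δ(O_T(x₀; n)) = d(x₀, Tᵏx₀)` (because `ψ(t) < t` for `t > 0`, the diameter cannot be attained
by two points `Tⁱx₀, Tʲx₀` with `i, j ≥ 1` unless it vanishes).
[cite: Berinde2007, Ch. 2 §2.6 Remark after Lemma 2.3] -/
theorem exists_orbitDiam_eq_dist (hφ : IsComparisonFunction5 φ)
    (hT : IsGeneralizedPhiContraction T φ) (x : X) (n : ℕ) :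
    ∃ k : ℕ, k ≤ n ∧ orbitDiam T x n = dist x (T^[k] x) := by
  obtain ⟨p, q, hp, hq, heq⟩ := exists_orbitDiam_eq T x n
  rcases Nat.eq_zero_or_pos p with rfl | hp0
  · exact ⟨q, hq, by simpa using heq⟩
  rcases Nat.eq_zero_or_pos q with rfl | hq0
  · refine ⟨p, hp, ?_⟩
    rw [heq, dist_comm]
    simp
  have h1 : orbitDiam T x n ≤ diag φ (orbitDiam T x n) :=
    calc orbitDiam T x n = dist (T^[p] x) (T^[q] x) := heq
      _ ≤ diag φ (orbitDiam T x n) := dist_iterate_le_diag_orbitDiam hφ hT x hp0 hp hq0 hq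
  have h0 : orbitDiam T x n = 0 := hφ.eq_zero_of_le_diag (orbitDiam_nonneg T x n) h1
  exact ⟨0, Nat.zero_le _, by simp [h0]⟩

/-- Lemma 2.4 in inverse-free form (Ćirić's Lemma 3): `δ(O_T(x₀; n)) - ψ(δ(O_T(x₀; n))) ≤
d(x₀, Tx₀)`, i.e. `h(δ(O_T(x₀; n))) ≤ d(x₀, Tx₀)` with `h` as in (25).
[cite: Berinde2007, Ch. 2 §2.6 Lemma 2.4] -/
theorem orbitDiam_sub_diag_le (hφ : IsComparisonFunction5 φ)
    (hT : IsGeneralizedPhiContraction T φ) (x : X) (n : ℕ) :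
    orbitDiam T x n - diag φ (orbitDiam T x n) ≤ dist x (T x) := by
  obtain ⟨k, hk, heq⟩ := exists_orbitDiam_eq_dist hφ hT x n
  rcases Nat.eq_zero_or_pos k with rfl | hk0
  · have h0 : orbitDiam T x n = 0 := by simpa using heq
    rw [h0, hφ.diag_zero, sub_zero]
    exact dist_nonneg
  · have hstep : dist (T x) (T^[k] x) ≤ diag φ (orbitDiam T x n) := by
      simpa using dist_iterate_le_iterate_diag_orbitDiam hφ hT x 1 n 1 k le_rfl (by omega)
        hk0 hk
    have h : orbitDiam T x n ≤ dist x (T x) + diag φ (orbitDiam T x n) :=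
      calc orbitDiam T x n = dist x (T^[k] x) := heq
        _ ≤ dist x (T x) + dist (T x) (T^[k] x) := dist_triangle _ _ _
        _ ≤ dist x (T x) + diag φ (orbitDiam T x n) := by linarith [hstep]
    linarith

/-- Lemma 2.4: if `h(t) = t - ψ(t)` is an increasing bijection of `ℝ₊` with inverse `g = h⁻¹`
(encoded as: every `t ≥ 0` with `t - ψ(t) ≤ s` satisfies `t ≤ g(s)`), then
`δ(O_T(x₀; n)) ≤ h⁻¹(d(x₀, Tx₀))` for every `n`.  [cite: Berinde2007, Ch. 2 §2.6 Lemma 2.4] -/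
theorem orbitDiam_le_of_inverse (hφ : IsComparisonFunction5 φ)
    (hT : IsGeneralizedPhiContraction T φ) {g : ℝ → ℝ}
    (hg : ∀ ⦃s t : ℝ⦄, 0 ≤ t → t - diag φ t ≤ s → t ≤ g s) (x : X) (n : ℕ) :
    orbitDiam T x n ≤ g (dist x (T x)) :=
  hg (orbitDiam_nonneg T x n) (orbitDiam_sub_diag_le hφ hT x n)

/-- Estimate (29) of the proof of Theorem 2.10: if all orbit segments of `x₀` have diameter
`≤ R`, then `d(Tⁱx₀, Tʲx₀) ≤ ψⁿ(R)` for all `i, j ≥ n`.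
[cite: Berinde2007, Ch. 2 §2.6 proof of Thm. 2.10 (29)] -/
theorem dist_iterate_le_of_orbitDiam_le (hφ : IsComparisonFunction5 φ)
    (hT : IsGeneralizedPhiContraction T φ) {x : X} {R : ℝ} (hR : ∀ m, orbitDiam T x m ≤ R)
    {n i j : ℕ} (hi : n ≤ i) (hj : n ≤ j) : dist (T^[i] x) (T^[j] x) ≤ (diag φ)^[n] R :=
  (dist_iterate_le_iterate_diag_orbitDiam hφ hT x n (max i j) i j hi (le_max_left _ _) hj
    (le_max_right _ _)).trans (hφ.iterate_diag_mono (orbitDiam_nonneg T x _) (hR _) n)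

/-- Proof of Theorem 2.10, Cauchy step: if the orbit segments of `x₀` have bounded diameters,
the Picard sequence `(Tⁿx₀)` is Cauchy (since `ψⁿ(R) → 0`).
[cite: Berinde2007, Ch. 2 §2.6 proof of Thm. 2.10 (29)] -/
theorem cauchySeq_iterate (hφ : IsComparisonFunction5 φ) (hT : IsGeneralizedPhiContraction T φ)
    {x : X} {R : ℝ} (hR : ∀ m, orbitDiam T x m ≤ R) : CauchySeq fun n => T^[n] x := by
  have hR0 : 0 ≤ R := (orbitDiam_nonneg T x 0).trans (hR 0)
  refine Metric.cauchySeq_iff'.2 fun ε hε => ?_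
  obtain ⟨N, hN⟩ := eventually_atTop.1 ((hφ.tendsto_iterate_diag hR0).eventually (gt_mem_nhds hε))
  refine ⟨N, fun n hn => ?_⟩
  calc dist (T^[n] x) (T^[N] x) ≤ (diag φ)^[N] R :=
        dist_iterate_le_of_orbitDiam_le hφ hT hR hn le_rfl
    _ < ε := hN N le_rfl

/-- Estimate (ii) of Theorem 2.10, orbit-wise: if the orbit segments of `x₀` have diameters
`≤ R` and `Tⁿx₀ → p`, then `d(Tⁿx₀, p) ≤ ψⁿ(R)` (let `m → ∞` in (29)).
[cite: Berinde2007, Ch. 2 §2.6 Thm. 2.10 (ii)] -/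
theorem dist_iterate_le_of_tendsto (hφ : IsComparisonFunction5 φ)
    (hT : IsGeneralizedPhiContraction T φ) {x : X} {R : ℝ} (hR : ∀ m, orbitDiam T x m ≤ R)
    {p : X} (hp : Tendsto (fun n => T^[n] x) atTop (𝓝 p)) (n : ℕ) :
    dist (T^[n] x) p ≤ (diag φ)^[n] R := by
  have ht : Tendsto (fun m => dist (T^[n] x) (T^[m] x)) atTop (𝓝 (dist (T^[n] x) p)) :=
    tendsto_const_nhds.dist hp
  exact le_of_tendsto ht
    (eventually_atTop.2 ⟨n, fun m hm => dist_iterate_le_of_orbitDiam_le hφ hT hR le_rfl hm⟩)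

/-- Proof of Theorem 2.10, fixed-point step (30)–(31): if `ψ` is continuous on `[0, ∞)`, the
limit `p` of a convergent Picard sequence `Tⁿx₀ → p` is a fixed point of `T`.  (All five
displacements in (30) are bounded by `d(p, Tp) + εₙ` with `εₙ → 0`, so
`d(p, Tp) ≤ d(p, xₙ₊₁) + ψ(d(p, Tp) + εₙ)`, and in the limit `d(p, Tp) ≤ ψ(d(p, Tp))`, forcing
`d(p, Tp) = 0` by Lemma 2.1 3).) [cite: Berinde2007, Ch. 2 §2.6 proof of Thm. 2.10 (30)–(31)] -/
theorem isFixedPt_of_tendsto (hφ : IsComparisonFunction5 φ) (hψc : ContinuousOn (diag φ) (Ici 0))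
    (hT : IsGeneralizedPhiContraction T φ) {x p : X} (hp : Tendsto (fun n => T^[n] x) atTop (𝓝 p)) :
    T p = p := by
  set D : ℝ := dist p (T p) with hD
  have hD0 : 0 ≤ D := dist_nonneg
  have hx1 : Tendsto (fun n => T^[n + 1] x) atTop (𝓝 p) := hp.comp (tendsto_add_atTop_nat 1)
  have e1 : Tendsto (fun n => dist (T^[n] x) p) atTop (𝓝 0) := by
    have h : Tendsto (fun n => dist (T^[n] x) p) atTop (𝓝 (dist p p)) :=
      hp.dist tendsto_const_nhds
    rwa [dist_self] at h
  have e2 : Tendsto (fun n => dist (T^[n] x) (T^[n + 1] x)) atTop (𝓝 0) := by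
    simpa using hp.dist hx1
  have e3 : Tendsto (fun n => dist p (T^[n + 1] x)) atTop (𝓝 0) := by
    have h : Tendsto (fun n => dist p (T^[n + 1] x)) atTop (𝓝 (dist p p)) :=
      tendsto_const_nhds.dist hx1
    rwa [dist_self] at h
  set e : ℕ → ℝ := fun n => dist (T^[n] x) p + dist (T^[n] x) (T^[n + 1] x) + dist p (T^[n + 1] x)
    with he_def
  have he : Tendsto e atTop (𝓝 0) := by simpa [he_def] using (e1.add e2).add e3
  have key : ∀ n, D ≤ dist p (T^[n + 1] x) + diag φ (D + e n) := by
    intro n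
    have hb1 : dist (T^[n] x) p ≤ D + e n := by
      simp only [he_def]; linarith [dist_nonneg (x := T^[n] x) (y := T^[n + 1] x),
        dist_nonneg (x := p) (y := T^[n + 1] x)]
    have hb2 : dist (T^[n] x) (T^[n + 1] x) ≤ D + e n := by
      simp only [he_def]; linarith [dist_nonneg (x := T^[n] x) (y := p),
        dist_nonneg (x := p) (y := T^[n + 1] x)]
    have hb3 : dist p (T p) ≤ D + e n := by
      simp only [he_def]; linarith [dist_nonneg (x := T^[n] x) (y := p),
        dist_nonneg (x := T^[n] x) (y := T^[n + 1] x), dist_nonneg (x := p) (y := T^[n + 1] x)]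
    have hb4 : dist (T^[n] x) (T p) ≤ D + e n := by
      have h4 : dist (T^[n] x) (T p) ≤ dist (T^[n] x) p + dist p (T p) := dist_triangle _ _ _
      simp only [he_def]; linarith [dist_nonneg (x := T^[n] x) (y := T^[n + 1] x),
        dist_nonneg (x := p) (y := T^[n + 1] x)]
    have hb5 : dist p (T^[n + 1] x) ≤ D + e n := by
      simp only [he_def]; linarith [dist_nonneg (x := T^[n] x) (y := p),
        dist_nonneg (x := T^[n] x) (y := T^[n + 1] x)]
    have hTn : dist (T^[n + 1] x) (T p) ≤ diag φ (D + e n) := by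
      rw [iterate_succ_apply']
      refine (hT _ _).trans
        (hφ.le_diag dist_nonneg dist_nonneg dist_nonneg dist_nonneg dist_nonneg hb1 ?_ hb3 hb4 ?_)
      · rw [← iterate_succ_apply' T n x]; exact hb2
      · rw [← iterate_succ_apply' T n x]; exact hb5
    calc D = dist p (T p) := rfl
      _ ≤ dist p (T^[n + 1] x) + dist (T^[n + 1] x) (T p) := dist_triangle _ _ _
      _ ≤ dist p (T^[n + 1] x) + diag φ (D + e n) := by linarith [hTn]
  have hin : Tendsto (fun n => D + e n) atTop (𝓝[Ici 0] D) := by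
    refine tendsto_nhdsWithin_iff.2 ⟨?_, Eventually.of_forall fun n => ?_⟩
    · simpa using tendsto_const_nhds.add he
    · have hen : 0 ≤ e n := by simp only [he_def]; positivity
      exact mem_Ici.2 (by linarith)
  have hlim : Tendsto (fun n => dist p (T^[n + 1] x) + diag φ (D + e n)) atTop
      (𝓝 (0 + diag φ D)) := e3.add ((hψc D (mem_Ici.2 hD0)).tendsto.comp hin)
  have hDle : D ≤ diag φ D := by
    have h := le_of_tendsto_of_tendsto' tendsto_const_nhds hlim key
    simpa using h
  have hzero : D = 0 := hφ.eq_zero_of_le_diag hD0 hDle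
  exact (dist_eq_zero.1 hzero).symm

/-- Theorem 2.10, uniqueness: a generalized `φ`-contraction has at most one fixed point
(`d(x*, y*) ≤ ψ(d(x*, y*))` forces `d(x*, y*) = 0`; no completeness needed).
[cite: Berinde2007, Ch. 2 §2.6 Thm. 2.10 (i)] -/
theorem fixedPoint_unique (hφ : IsComparisonFunction5 φ) (hT : IsGeneralizedPhiContraction T φ)
    {p q : X} (hp : T p = p) (hq : T q = q) : p = q := by
  have h : dist p q ≤ diag φ (dist p q) := by
    have h0 := hT p q
    rw [hp, hq] at h0
    refine h0.trans (hφ.le_diag dist_nonneg dist_nonneg dist_nonneg dist_nonneg dist_nonneg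
      le_rfl ?_ ?_ le_rfl ?_)
    · rw [dist_self]; exact dist_nonneg
    · rw [dist_self]; exact dist_nonneg
    · rw [dist_comm]
  exact dist_eq_zero.1 (hφ.eq_zero_of_le_diag dist_nonneg h)

/-- Theorem 2.10, orbit-wise form: in a complete metric space, if `ψ` is continuous on `[0, ∞)`
and the orbit segments of `x₀` have diameters `≤ R`, then `Tⁿx₀` converges to a fixed point `p`
of `T` and `d(Tⁿx₀, p) ≤ ψⁿ(R)`. [cite: Berinde2007, Ch. 2 §2.6 Thm. 2.10] -/
theorem exists_fixedPoint_tendsto_iterate_of_orbitDiam_le [CompleteSpace X]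
    (hφ : IsComparisonFunction5 φ) (hψc : ContinuousOn (diag φ) (Ici 0))
    (hT : IsGeneralizedPhiContraction T φ) {x : X} {R : ℝ} (hR : ∀ m, orbitDiam T x m ≤ R) :
    ∃ p : X, T p = p ∧ Tendsto (fun n => T^[n] x) atTop (𝓝 p) ∧
      ∀ n, dist (T^[n] x) p ≤ (diag φ)^[n] R := by
  obtain ⟨p, hp⟩ := cauchySeq_tendsto_of_complete (cauchySeq_iterate hφ hT hR)
  exact ⟨p, isFixedPt_of_tendsto hφ hψc hT hp, hp, dist_iterate_le_of_tendsto hφ hT hR hp⟩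

/-- **Theorem 2.10** (Berinde; existence, convergence and estimate (ii)).  Let `(X, d)` be
complete, `T` a generalized `φ`-contraction with `φ` a 5-dimensional comparison function whose
diagonal `ψ` is continuous (on `[0, ∞)`) and such that `h(t) = t - ψ(t)` is an increasing
bijection with inverse `g = h⁻¹` (encoded by `hg`, deviation (b)).  Then for every `x₀` the
Picard sequence `Tⁿx₀` converges to a fixed point `x*` of `T` and
`d(Tⁿx₀, x*) ≤ ψⁿ(h⁻¹(d(x₀, Tx₀)))`. [cite: Berinde2007, Ch. 2 §2.6 Thm. 2.10 (i)–(ii)] -/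
theorem exists_fixedPoint_tendsto_iterate [CompleteSpace X] (hφ : IsComparisonFunction5 φ)
    (hψc : ContinuousOn (diag φ) (Ici 0)) (hT : IsGeneralizedPhiContraction T φ) {g : ℝ → ℝ}
    (hg : ∀ ⦃s t : ℝ⦄, 0 ≤ t → t - diag φ t ≤ s → t ≤ g s) (x : X) :
    ∃ p : X, T p = p ∧ Tendsto (fun n => T^[n] x) atTop (𝓝 p) ∧
      ∀ n, dist (T^[n] x) p ≤ (diag φ)^[n] (g (dist x (T x))) :=
  exists_fixedPoint_tendsto_iterate_of_orbitDiam_le hφ hψc hT (orbitDiam_le_of_inverse hφ hT hg x)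

/-- **Theorem 2.10 (i)**: under the hypotheses of Theorem 2.10, on a nonempty complete metric
space `T` has exactly one fixed point (`T` is a Picard mapping).
[cite: Berinde2007, Ch. 2 §2.6 Thm. 2.10 (i)] -/
theorem existsUnique_fixedPoint [CompleteSpace X] [Nonempty X] (hφ : IsComparisonFunction5 φ)
    (hψc : ContinuousOn (diag φ) (Ici 0)) (hT : IsGeneralizedPhiContraction T φ) {g : ℝ → ℝ}
    (hg : ∀ ⦃s t : ℝ⦄, 0 ≤ t → t - diag φ t ≤ s → t ≤ g s) : ∃! p : X, T p = p := by
  obtain ⟨p, hp, -, -⟩ := exists_fixedPoint_tendsto_iterate hφ hψc hT hg (Classical.arbitrary X)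
  exact ⟨p, hp, fun q hq => fixedPoint_unique hφ hT hq hp⟩

/-- **Theorem 2.10 (i)**, convergence to *the* fixed point: under the hypotheses of Theorem 2.10,
every Picard sequence converges to any given fixed point `x*`.
[cite: Berinde2007, Ch. 2 §2.6 Thm. 2.10 (i)] -/
theorem tendsto_iterate_fixedPoint [CompleteSpace X] (hφ : IsComparisonFunction5 φ)
    (hψc : ContinuousOn (diag φ) (Ici 0)) (hT : IsGeneralizedPhiContraction T φ) {g : ℝ → ℝ}
    (hg : ∀ ⦃s t : ℝ⦄, 0 ≤ t → t - diag φ t ≤ s → t ≤ g s) {p : X} (hp : T p = p) (x : X) :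
    Tendsto (fun n => T^[n] x) atTop (𝓝 p) := by
  obtain ⟨q, hq, hqt, -⟩ := exists_fixedPoint_tendsto_iterate hφ hψc hT hg x
  rwa [fixedPoint_unique hφ hT hp hq]

/-- **Theorem 2.10 (ii)**: under the hypotheses of Theorem 2.10, for the fixed point `x*`,
`d(Tⁿx₀, x*) ≤ ψⁿ(h⁻¹(d(x₀, Tx₀)))` for all `n` and `x₀`.
[cite: Berinde2007, Ch. 2 §2.6 Thm. 2.10 (ii)] -/
theorem dist_iterate_fixedPoint_le [CompleteSpace X] (hφ : IsComparisonFunction5 φ)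
    (hψc : ContinuousOn (diag φ) (Ici 0)) (hT : IsGeneralizedPhiContraction T φ) {g : ℝ → ℝ}
    (hg : ∀ ⦃s t : ℝ⦄, 0 ≤ t → t - diag φ t ≤ s → t ≤ g s) {p : X} (hp : T p = p) (x : X)
    (n : ℕ) : dist (T^[n] x) p ≤ (diag φ)^[n] (g (dist x (T x))) := by
  obtain ⟨q, hq, -, hest⟩ := exists_fixedPoint_tendsto_iterate hφ hψc hT hg x
  rw [fixedPoint_unique hφ hT hp hq]
  exact hest n

/-- Theorem 2.10 for a linear diagonal `ψ(t) = c t`, `c < 1` (the situation of Example 2.10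
1)–5), 7)): `h⁻¹(s) = s/(1 - c)`, `ψⁿ(h⁻¹(s)) = cⁿ s/(1 - c)`, so every Picard sequence converges
to a fixed point `p`, fixed points are unique, and `d(Tⁿx₀, p) ≤ cⁿ/(1 - c) · d(x₀, Tx₀)`.
[cite: Berinde2007, Ch. 2 §2.6 Thm. 2.10 with Example 2.10] -/
theorem picard_of_linear [CompleteSpace X] {c : ℝ}
    (mono : ∀ ⦃t₁ t₂ t₃ t₄ t₅ s₁ s₂ s₃ s₄ s₅ : ℝ⦄, 0 ≤ t₁ → 0 ≤ t₂ → 0 ≤ t₃ → 0 ≤ t₄ → 0 ≤ t₅ →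
      t₁ ≤ s₁ → t₂ ≤ s₂ → t₃ ≤ s₃ → t₄ ≤ s₄ → t₅ ≤ s₅ → φ t₁ t₂ t₃ t₄ t₅ ≤ φ s₁ s₂ s₃ s₄ s₅)
    (nonneg : ∀ ⦃t₁ t₂ t₃ t₄ t₅ : ℝ⦄, 0 ≤ t₁ → 0 ≤ t₂ → 0 ≤ t₃ → 0 ≤ t₄ → 0 ≤ t₅ →
      0 ≤ φ t₁ t₂ t₃ t₄ t₅)
    (hc : c < 1) (hψ : ∀ t, 0 ≤ t → diag φ t = c * t) (hT : IsGeneralizedPhiContraction T φ)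
    (x : X) :
    ∃ p : X, T p = p ∧ (∀ q, T q = q → q = p) ∧ Tendsto (fun n => T^[n] x) atTop (𝓝 p) ∧
      ∀ n, dist (T^[n] x) p ≤ c ^ n / (1 - c) * dist x (T x) := by
  have hφ : IsComparisonFunction5 φ := IsComparisonFunction5.of_linear mono nonneg hc hψ
  have hc0 : 0 ≤ c := IsComparisonFunction5.linear_coeff_nonneg nonneg hψ
  have hg := IsComparisonFunction5.le_div_of_sub_diag_le_linear hc hψ
  obtain ⟨p, hp, hpt, hest⟩ := exists_fixedPoint_tendsto_iterate hφ
    (IsComparisonFunction5.continuousOn_diag_linear hψ) hT hg x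
  refine ⟨p, hp, fun q hq => fixedPoint_unique hφ hT hq hp, hpt, fun n => ?_⟩
  have hd0 : 0 ≤ dist x (T x) / (1 - c) := div_nonneg dist_nonneg (by linarith)
  calc dist (T^[n] x) p ≤ (diag φ)^[n] (dist x (T x) / (1 - c)) := hest n
    _ = c ^ n * (dist x (T x) / (1 - c)) := IsComparisonFunction5.iterate_diag_linear hc0 hψ hd0 n
    _ = c ^ n / (1 - c) * dist x (T x) := by ring

end IsGeneralizedPhiContraction

/-! ## Particular cases of Theorem 2.10 -/

section ParticularCases

variable {T : X → X}

/-! ### 1) Ćirić's quasi-contractions -/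

/-- Ćirić's *quasi-contractions* [Ciric1974]: there is `a ∈ [0, 1)` with
`d(Tx, Ty) ≤ a · max {d(x, y), d(x, Tx), d(y, Ty), d(x, Ty), d(y, Tx)}` for all `x, y`; this is
the generalized `φ`-contraction for `φ` of Example 2.10 1).
[cite: Ciric1974, Definition of quasi-contraction][cite: Berinde2007, Ch. 2 §2.6 Example 2.10 1)] -/
def IsQuasiContraction (T : X → X) (a : ℝ) : Prop :=
  ∀ x y : X, dist (T x) (T y) ≤
    a * max (dist x y) (max (dist x (T x)) (max (dist y (T y)) (max (dist x (T y)) (dist y (T x)))))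

namespace IsQuasiContraction

variable {a : ℝ}

/-- A quasi-contraction with constant `a` is a generalized `φ`-contraction for
`φ(t) = a · max {t₁, …, t₅}` (Example 2.10 1)). [cite: Berinde2007, Ch. 2 §2.6 Example 2.10 1)] -/
theorem isGeneralizedPhiContraction (h : IsQuasiContraction T a) :
    IsGeneralizedPhiContraction T
      fun t₁ t₂ t₃ t₄ t₅ => a * max t₁ (max t₂ (max t₃ (max t₄ t₅))) :=
  fun x y => h x y

/-- For `a ∈ [0, 1)`, `φ(t) = a · max {t₁, …, t₅}` is monotone with linear diagonal `ψ(t) = a t`.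
[cite: Berinde2007, Ch. 2 §2.6 Example 2.10 1)] -/
theorem diag_eq (a t : ℝ) :
    diag (fun t₁ t₂ t₃ t₄ t₅ => a * max t₁ (max t₂ (max t₃ (max t₄ t₅)))) t = a * t := by
  simp

/-- **Ćirić's theorem** [Ciric1974, Theorem 1] = Particular case 1) of Theorem 2.10: a
quasi-contraction with `a ∈ [0, 1)` on a complete metric space has a unique fixed point `x*`,
every Picard sequence converges to it, and `d(Tⁿx₀, x*) ≤ aⁿ/(1 - a) · d(x₀, Tx₀)`.
[cite: Ciric1974, Theorem 1][cite: Berinde2007, Ch. 2 §2.6 Thm. 2.10, Particular case 1)] -/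
theorem picard [CompleteSpace X] (h : IsQuasiContraction T a) (ha0 : 0 ≤ a) (ha1 : a < 1)
    (x : X) :
    ∃ p : X, T p = p ∧ (∀ q, T q = q → q = p) ∧ Tendsto (fun n => T^[n] x) atTop (𝓝 p) ∧
      ∀ n, dist (T^[n] x) p ≤ a ^ n / (1 - a) * dist x (T x) := by
  refine IsGeneralizedPhiContraction.picard_of_linear ?_ ?_ ha1 (fun t _ => diag_eq a t)
    h.isGeneralizedPhiContraction x
  · intro t₁ t₂ t₃ t₄ t₅ s₁ s₂ s₃ s₄ s₅ _ _ _ _ _ k₁ k₂ k₃ k₄ k₅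
    exact mul_le_mul_of_nonneg_left
      (max_le_max k₁ (max_le_max k₂ (max_le_max k₃ (max_le_max k₄ k₅)))) ha0
  · intro t₁ t₂ t₃ t₄ t₅ h₁ _ _ _ _
    exact mul_nonneg ha0 (le_max_of_le_left h₁)

/-- Ćirić's theorem, existence and uniqueness: a quasi-contraction (`a ∈ [0, 1)`) on a nonempty
complete metric space has exactly one fixed point.
[cite: Ciric1974, Theorem 1 (a)][cite: Berinde2007, Ch. 2 §2.6 Thm. 2.10, Particular case 1)] -/
theorem existsUnique_fixedPoint [CompleteSpace X] [Nonempty X] (h : IsQuasiContraction T a)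
    (ha0 : 0 ≤ a) (ha1 : a < 1) : ∃! p : X, T p = p := by
  obtain ⟨p, hp, huniq, -, -⟩ := h.picard ha0 ha1 (Classical.arbitrary X)
  exact ⟨p, hp, huniq⟩

/-- Ćirić's theorem, convergence: every Picard sequence of a quasi-contraction converges to its
fixed point. [cite: Ciric1974, Theorem 1 (b)][cite: Berinde2007, Ch. 2 §2.6 Thm. 2.10 (i)] -/
theorem tendsto_iterate_fixedPoint [CompleteSpace X] (h : IsQuasiContraction T a) (ha0 : 0 ≤ a)
    (ha1 : a < 1) {p : X} (hp : T p = p) (x : X) : Tendsto (fun n => T^[n] x) atTop (𝓝 p) := by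
  obtain ⟨q, _, huniq, hqt, -⟩ := h.picard ha0 ha1 x
  rwa [huniq p hp]

/-- Ćirić's theorem, rate: `d(Tⁿx₀, x*) ≤ aⁿ/(1 - a) · d(x₀, Tx₀)`.
[cite: Ciric1974, Theorem 1 (c)][cite: Berinde2007, Ch. 2 §2.6 Thm. 2.10 (ii)] -/
theorem dist_iterate_fixedPoint_le [CompleteSpace X] (h : IsQuasiContraction T a) (ha0 : 0 ≤ a)
    (ha1 : a < 1) {p : X} (hp : T p = p) (x : X) (n : ℕ) :
    dist (T^[n] x) p ≤ a ^ n / (1 - a) * dist x (T x) := by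
  obtain ⟨q, _, huniq, -, hest⟩ := h.picard ha0 ha1 x
  rw [huniq p hp]
  exact hest n

/-- Ćirić's Lemma 3 (= Lemma 2.4 for `φ = a · max`): the orbit of a quasi-contraction is bounded,
`δ(O_T(x₀; n)) ≤ d(x₀, Tx₀)/(1 - a)` for every `n` (no completeness needed).
[cite: Ciric1974, Lemma 3][cite: Berinde2007, Ch. 2 §2.6 Lemma 2.4] -/
theorem orbitDiam_le (h : IsQuasiContraction T a) (ha0 : 0 ≤ a) (ha1 : a < 1) (x : X) (n : ℕ) :
    orbitDiam T x n ≤ dist x (T x) / (1 - a) := by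
  have hψ : ∀ t : ℝ, 0 ≤ t →
      diag (fun t₁ t₂ t₃ t₄ t₅ => a * max t₁ (max t₂ (max t₃ (max t₄ t₅)))) t = a * t :=
    fun t _ => diag_eq a t
  have hφ : IsComparisonFunction5 fun t₁ t₂ t₃ t₄ t₅ => a * max t₁ (max t₂ (max t₃ (max t₄ t₅))) :=
    IsComparisonFunction5.of_linear
      (fun t₁ t₂ t₃ t₄ t₅ s₁ s₂ s₃ s₄ s₅ _ _ _ _ _ k₁ k₂ k₃ k₄ k₅ => mul_le_mul_of_nonneg_left
        (max_le_max k₁ (max_le_max k₂ (max_le_max k₃ (max_le_max k₄ k₅)))) ha0)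
      (fun t₁ t₂ t₃ t₄ t₅ h₁ _ _ _ _ => mul_nonneg ha0 (le_max_of_le_left h₁)) ha1 hψ
  exact IsGeneralizedPhiContraction.orbitDiam_le_of_inverse hφ h.isGeneralizedPhiContraction
    (IsComparisonFunction5.le_div_of_sub_diag_le_linear ha1 hψ) x n

/-- Ćirić's Lemma 1 (= Lemma 2.3 for `φ = a · max`): `d(Tⁱx₀, Tʲx₀) ≤ a · δ(O_T(x₀; n))` for
`1 ≤ i, j ≤ n`. [cite: Ciric1974, Lemma 1][cite: Berinde2007, Ch. 2 §2.6 Lemma 2.3] -/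
theorem dist_iterate_le (h : IsQuasiContraction T a) (ha0 : 0 ≤ a) (ha1 : a < 1) (x : X)
    {n i j : ℕ} (hi : 1 ≤ i) (hin : i ≤ n) (hj : 1 ≤ j) (hjn : j ≤ n) :
    dist (T^[i] x) (T^[j] x) ≤ a * orbitDiam T x n := by
  have hψ : ∀ t : ℝ, 0 ≤ t →
      diag (fun t₁ t₂ t₃ t₄ t₅ => a * max t₁ (max t₂ (max t₃ (max t₄ t₅)))) t = a * t :=
    fun t _ => diag_eq a t
  have hφ : IsComparisonFunction5 fun t₁ t₂ t₃ t₄ t₅ => a * max t₁ (max t₂ (max t₃ (max t₄ t₅))) :=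
    IsComparisonFunction5.of_linear
      (fun t₁ t₂ t₃ t₄ t₅ s₁ s₂ s₃ s₄ s₅ _ _ _ _ _ k₁ k₂ k₃ k₄ k₅ => mul_le_mul_of_nonneg_left
        (max_le_max k₁ (max_le_max k₂ (max_le_max k₃ (max_le_max k₄ k₅)))) ha0)
      (fun t₁ t₂ t₃ t₄ t₅ h₁ _ _ _ _ => mul_nonneg ha0 (le_max_of_le_left h₁)) ha1 hψ
  have h1 := IsGeneralizedPhiContraction.dist_iterate_le_diag_orbitDiam hφ
    h.isGeneralizedPhiContraction x hi hin hj hjn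
  rwa [diag_eq] at h1

/-- A Banach contraction (`d(Tx, Ty) ≤ a d(x, y)`, `a ≥ 0`) is a quasi-contraction with the same
constant. [cite: Ciric1974, Introduction][cite: Berinde2007, Ch. 2 §2.6 Example 2.10 1)] -/
theorem of_lipschitzWith {K : NNReal} (hT : LipschitzWith K T) : IsQuasiContraction T K := by
  intro x y
  refine (hT.dist_le_mul x y).trans ?_
  exact mul_le_mul_of_nonneg_left (le_max_left _ _) K.coe_nonneg

end IsQuasiContraction

/-! ### 2) Kannan, 3) Reich–Rus, 4) Bianchini, 5) Zamfirescu (and Chatterjea) -/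

/-- Particular case 2) of Theorem 2.10 = **Kannan's theorem** (Theorem 2.3) via Example 2.10 3),
`φ(t) = b(t₂ + t₃)`, `b ∈ [0, 1/2)`, `ψ(t) = 2b t`: if `d(Tx, Ty) ≤ b [d(x, Tx) + d(y, Ty)]` on a
complete metric space then `T` is a Picard mapping and Theorem 2.10 (ii) gives
`d(Tⁿx₀, x*) ≤ (2b)ⁿ/(1 - 2b) · d(x₀, Tx₀)`.  (Kannan's theorem with the constants of
Corollary 2.3 is `AlmostContractions.IsKannanMapping.existsUnique_fixedPoint`.)
[cite: Berinde2007, Ch. 2 §2.6 Thm. 2.10, Particular case 2), Example 2.10 3)] -/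
theorem picard_of_kannan [CompleteSpace X] {b : ℝ} (hb0 : 0 ≤ b) (hb : b < 1 / 2)
    (h : ∀ x y : X, dist (T x) (T y) ≤ b * (dist x (T x) + dist y (T y))) (x : X) :
    ∃ p : X, T p = p ∧ (∀ q, T q = q → q = p) ∧ Tendsto (fun n => T^[n] x) atTop (𝓝 p) ∧
      ∀ n, dist (T^[n] x) p ≤ (2 * b) ^ n / (1 - 2 * b) * dist x (T x) := by
  refine IsGeneralizedPhiContraction.picard_of_linear (φ := fun _ t₂ t₃ _ _ => b * (t₂ + t₃))
    ?_ ?_ (by linarith) ?_ (fun x y => h x y) x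
  · intro t₁ t₂ t₃ t₄ t₅ s₁ s₂ s₃ s₄ s₅ _ _ _ _ _ _ k₂ k₃ _ _
    exact mul_le_mul_of_nonneg_left (add_le_add k₂ k₃) hb0
  · intro t₁ t₂ t₃ t₄ t₅ _ h₂ h₃ _ _
    exact mul_nonneg hb0 (add_nonneg h₂ h₃)
  · intro t _
    simp only [diag_apply]
    ring

/-- Chatterjea's condition (34) (§2.7, Proposition 2.3; Example 2.10-type function
`φ(t) = c(t₄ + t₅)`, `c ∈ [0, 1/2)`, `ψ(t) = 2c t`): if `d(Tx, Ty) ≤ c [d(x, Ty) + d(y, Tx)]` on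
a complete metric space then `T` is a Picard mapping with
`d(Tⁿx₀, x*) ≤ (2c)ⁿ/(1 - 2c) · d(x₀, Tx₀)` by Theorem 2.10 (ii).  (Chatterjea's theorem via weak
contractions is `AlmostContractions.IsChatterjeaMapping.existsUnique_fixedPoint`.)
[cite: Berinde2007, Ch. 2 §2.7 Prop. 2.3 (34) with §2.6 Thm. 2.10] -/
theorem picard_of_chatterjea [CompleteSpace X] {c : ℝ} (hc0 : 0 ≤ c) (hc : c < 1 / 2)
    (h : ∀ x y : X, dist (T x) (T y) ≤ c * (dist x (T y) + dist y (T x))) (x : X) :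
    ∃ p : X, T p = p ∧ (∀ q, T q = q → q = p) ∧ Tendsto (fun n => T^[n] x) atTop (𝓝 p) ∧
      ∀ n, dist (T^[n] x) p ≤ (2 * c) ^ n / (1 - 2 * c) * dist x (T x) := by
  refine IsGeneralizedPhiContraction.picard_of_linear (φ := fun _ _ _ t₄ t₅ => c * (t₄ + t₅))
    ?_ ?_ (by linarith) ?_ (fun x y => h x y) x
  · intro t₁ t₂ t₃ t₄ t₅ s₁ s₂ s₃ s₄ s₅ _ _ _ _ _ _ _ _ k₄ k₅
    exact mul_le_mul_of_nonneg_left (add_le_add k₄ k₅) hc0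
  · intro t₁ t₂ t₃ t₄ t₅ _ _ _ h₄ h₅
    exact mul_nonneg hc0 (add_nonneg h₄ h₅)
  · intro t _
    simp only [diag_apply]
    ring

/-- Particular case 3) of Theorem 2.10 = the **Reich–Rus theorem** (Reich 1971, Rus 1971) via
Example 2.10 4), `φ(t) = a t₁ + b(t₂ + t₃)` with `a, b ≥ 0`, `a + 2b < 1`, `ψ(t) = (a + 2b) t`:
if `d(Tx, Ty) ≤ a d(x, y) + b [d(x, Tx) + d(y, Ty)]` on a complete metric space then `T` is a
Picard mapping with `d(Tⁿx₀, x*) ≤ (a + 2b)ⁿ/(1 - a - 2b) · d(x₀, Tx₀)`.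
[cite: Berinde2007, Ch. 2 §2.6 Thm. 2.10, Particular case 3), Example 2.10 4)] -/
theorem picard_of_reichRus [CompleteSpace X] {a b : ℝ} (ha0 : 0 ≤ a) (hb0 : 0 ≤ b)
    (hab : a + 2 * b < 1)
    (h : ∀ x y : X, dist (T x) (T y) ≤ a * dist x y + b * (dist x (T x) + dist y (T y))) (x : X) :
    ∃ p : X, T p = p ∧ (∀ q, T q = q → q = p) ∧ Tendsto (fun n => T^[n] x) atTop (𝓝 p) ∧
      ∀ n, dist (T^[n] x) p ≤ (a + 2 * b) ^ n / (1 - (a + 2 * b)) * dist x (T x) := by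
  refine IsGeneralizedPhiContraction.picard_of_linear
    (φ := fun t₁ t₂ t₃ _ _ => a * t₁ + b * (t₂ + t₃)) ?_ ?_ hab ?_ (fun x y => h x y) x
  · intro t₁ t₂ t₃ t₄ t₅ s₁ s₂ s₃ s₄ s₅ _ _ _ _ _ k₁ k₂ k₃ _ _
    exact add_le_add (mul_le_mul_of_nonneg_left k₁ ha0)
      (mul_le_mul_of_nonneg_left (add_le_add k₂ k₃) hb0)
  · intro t₁ t₂ t₃ t₄ t₅ h₁ h₂ h₃ _ _
    exact add_nonneg (mul_nonneg ha0 h₁) (mul_nonneg hb0 (add_nonneg h₂ h₃))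
  · intro t _
    simp only [diag_apply]
    ring

/-- Particular case 4) of Theorem 2.10 = the **Bianchini theorem** (Bianchini 1972, Dugundji
1976) via Example 2.10 5), `φ(t) = a · max {t₂, t₃}`, `a ∈ [0, 1)`, `ψ(t) = a t`: if
`d(Tx, Ty) ≤ a · max {d(x, Tx), d(y, Ty)}` on a complete metric space then `T` is a Picard
mapping with `d(Tⁿx₀, x*) ≤ aⁿ/(1 - a) · d(x₀, Tx₀)`.
[cite: Berinde2007, Ch. 2 §2.6 Thm. 2.10, Particular case 4), Example 2.10 5)] -/
theorem picard_of_bianchini [CompleteSpace X] {a : ℝ} (ha0 : 0 ≤ a) (ha1 : a < 1)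
    (h : ∀ x y : X, dist (T x) (T y) ≤ a * max (dist x (T x)) (dist y (T y))) (x : X) :
    ∃ p : X, T p = p ∧ (∀ q, T q = q → q = p) ∧ Tendsto (fun n => T^[n] x) atTop (𝓝 p) ∧
      ∀ n, dist (T^[n] x) p ≤ a ^ n / (1 - a) * dist x (T x) := by
  refine IsGeneralizedPhiContraction.picard_of_linear (φ := fun _ t₂ t₃ _ _ => a * max t₂ t₃)
    ?_ ?_ ha1 ?_ (fun x y => h x y) x
  · intro t₁ t₂ t₃ t₄ t₅ s₁ s₂ s₃ s₄ s₅ _ _ _ _ _ _ k₂ k₃ _ _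
    exact mul_le_mul_of_nonneg_left (max_le_max k₂ k₃) ha0
  · intro t₁ t₂ t₃ t₄ t₅ _ h₂ _ _ _
    exact mul_nonneg ha0 (le_max_of_le_left h₂)
  · intro t _
    simp

/-- Particular case 5) of Theorem 2.10 = **Zamfirescu's theorem** (Theorem 2.4) via Example 2.10
7), `φ(t) = max {α t₁, β(t₂ + t₃), γ(t₄ + t₅)}` (deviation (e)), `α ∈ [0, 1)`,
`β, γ ∈ [0, 1/2)`, `ψ(t) = max {α, 2β, 2γ} · t`: if for every `x, y` at least one of
(z₁) `d(Tx, Ty) ≤ α d(x, y)`, (z₂) `d(Tx, Ty) ≤ β [d(x, Tx) + d(y, Ty)]`,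
(z₃) `d(Tx, Ty) ≤ γ [d(x, Ty) + d(y, Tx)]` holds, then on a complete metric space `T` is a Picard
mapping with `d(Tⁿx₀, x*) ≤ cⁿ/(1 - c) · d(x₀, Tx₀)`, `c = max {α, 2β, 2γ}`.  (Zamfirescu's
theorem with the constant `δ = max {α, β/(1 - β), γ/(1 - γ)}` of the Remark after Theorem 2.4 is
`AlmostContractions.IsZamfirescuMapping.existsUnique_fixedPoint`.)
[cite: Berinde2007, Ch. 2 §2.6 Thm. 2.10, Particular case 5), Example 2.10 7)] -/
theorem picard_of_zamfirescu [CompleteSpace X] {α β γ : ℝ} (hα0 : 0 ≤ α) (hα1 : α < 1)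
    (hβ0 : 0 ≤ β) (hβ : β < 1 / 2) (hγ0 : 0 ≤ γ) (hγ : γ < 1 / 2)
    (h : ∀ x y : X, dist (T x) (T y) ≤ α * dist x y ∨
      dist (T x) (T y) ≤ β * (dist x (T x) + dist y (T y)) ∨
      dist (T x) (T y) ≤ γ * (dist x (T y) + dist y (T x))) (x : X) :
    ∃ p : X, T p = p ∧ (∀ q, T q = q → q = p) ∧ Tendsto (fun n => T^[n] x) atTop (𝓝 p) ∧
      ∀ n, dist (T^[n] x) p ≤
        (max α (max (2 * β) (2 * γ))) ^ n / (1 - max α (max (2 * β) (2 * γ))) * dist x (T x) := by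
  have hc : max α (max (2 * β) (2 * γ)) < 1 := max_lt hα1 (max_lt (by linarith) (by linarith))
  refine IsGeneralizedPhiContraction.picard_of_linear
    (φ := fun t₁ t₂ t₃ t₄ t₅ => max (α * t₁) (max (β * (t₂ + t₃)) (γ * (t₄ + t₅)))) ?_ ?_ hc ?_
    ?_ x
  · intro t₁ t₂ t₃ t₄ t₅ s₁ s₂ s₃ s₄ s₅ _ _ _ _ _ k₁ k₂ k₃ k₄ k₅
    exact max_le_max (mul_le_mul_of_nonneg_left k₁ hα0) (max_le_max
      (mul_le_mul_of_nonneg_left (add_le_add k₂ k₃) hβ0)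
      (mul_le_mul_of_nonneg_left (add_le_add k₄ k₅) hγ0))
  · intro t₁ t₂ t₃ t₄ t₅ h₁ _ _ _ _
    exact le_max_of_le_left (mul_nonneg hα0 h₁)
  · intro t ht
    simp only [diag_apply]
    rw [show β * (t + t) = 2 * β * t by ring, show γ * (t + t) = 2 * γ * t by ring,
      max_mul_of_nonneg _ _ ht, max_mul_of_nonneg _ _ ht]
  · intro x y
    rcases h x y with h₁ | h₂ | h₃
    · exact h₁.trans (le_max_left _ _)
    · exact h₂.trans ((le_max_left _ _).trans (le_max_right _ _))
    · exact h₃.trans ((le_max_right _ _).trans (le_max_right _ _))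

end ParticularCases

end Literature.Analysis.Convex.GeneralizedPhiContractions
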